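/-
Origin: expansion seat `planner-pub-hodgecm-toy2-g2-0`, handover 2026-08-18 (`HOME/pub-hodgecm-toy2-g2/lean/Toy2g2/Frame.lean`, md5 3e3575ed, 104 lines);
landed by the gen-6 packager in gate run 22 as `HodgeCM/Model/SexticCM/Frame.lean` (import ^import Toy2g2\.→import HodgeCM.Model.SexticCM. ×1).
-/
/-
Copyright: pub-hodgecm formalisation cell (harness21, 2026). New file (not vendored).
Origin: HOME/pub-hodgecm-toy2-g2/lean/Toy2g2/Frame.lean (WIP module `Toy2g2.Frame`; intended final place
`HodgeCM/Model/SexticCM/Frame.lean` = module `HodgeCM.Model.SexticCM.Frame`, CONTRIBUTING §3 L5) (seat planner-pub-hodgecm-toy2-g2-0,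
consistency seat 2 gen 2, part (6a)(ii): PerL's hypotheses are inhabited — the frame phi_j : delta_0 -> delta_j and the four CM types of sign pattern perlSign).
-/
import Summits.HodgeConjecture.HodgeCM.Model.SexticCM.SexticField
import Summits.HodgeConjecture.HodgeCM.CM.Basic

/-!
# A frame of `K` and CM types realising PerL's sign table
-/

open Polynomial IntermediateField NumberField NumberField.ComplexEmbedding

noncomputable section

namespace HodgeCM.SexticCM

open Literature.AlgebraicGeometry.Motives (CMType)

/-- (Ported verbatim from the HodgeCMPerL package; no docstring in the source.) -/
lemma δ_mem_aroots (m : Fin 3) : δ m ∈ (minpoly ℚ (δ 0)).aroots ℂ := by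
  rw [minpoly_δ0, mem_aroots]
  exact ⟨mκ_ne_zero, aeval_δ m⟩

/-- the embedding `K → ℂ` with `δ₀ ↦ δ_m` -/
def embOf (m : Fin 3) : K →+* ℂ :=
  ((algHomAdjoinIntegralEquiv ℚ (isIntegral_δ 0)).symm ⟨δ m, δ_mem_aroots m⟩).toRingHom

/-- (Ported verbatim from the HodgeCMPerL package; no docstring in the source.) -/
lemma embOf_δ0K (m : Fin 3) : embOf m δ0K = δ m :=
  algHomAdjoinIntegralEquiv_symm_apply_gen ℚ (isIntegral_δ 0) ⟨δ m, δ_mem_aroots m⟩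

/-- The frame `φ₀ = id, φ₁, φ₂` (with `φ_j(δ₀) = δ_j`). -/
def φfr (j : Fin 3) : K →+* ℂ := if j = 0 then algebraMap K ℂ else embOf j

/-- (Ported verbatim from the HodgeCMPerL package; no docstring in the source.) -/
lemma φfr_zero : φfr 0 = algebraMap K ℂ := by simp [φfr]

/-- (Ported verbatim from the HodgeCMPerL package; no docstring in the source.) -/
@[simp] lemma φfr_δ0K (j : Fin 3) : φfr j δ0K = δ j := by
  by_cases h : j = 0
  · subst h; rfl
  · simp [φfr, h, embOf_δ0K]

/-- (Ported verbatim from the HodgeCMPerL package; no docstring in the source.) -/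
@[simp] lemma conjugate_φfr_δ0K (j : Fin 3) : conjugate (φfr j) δ0K = -δ j := by
  rw [conjugate_coe_eq, φfr_δ0K, conj_δ]

/-- (Ported verbatim from the HodgeCMPerL package; no docstring in the source.) -/
lemma isFrame : IsFrame φfr := by
  intro j j' hjj' h
  rw [InfinitePlace.mk_eq_iff] at h
  rcases h with h | h
  · have := congrArg (fun ψ : K →+* ℂ => ψ δ0K) h
    simp only [φfr_δ0K] at this
    exact hjj' (δ_injective this)
  · have := congrArg (fun ψ : K →+* ℂ => ψ δ0K) h
    simp only [conjugate_φfr_δ0K, φfr_δ0K] at this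
    exact δ_ne_neg j' j this.symm

/-- every embedding sends `δ₀` to `±δ_m` -/
lemma emb_classify (ψ : K →+* ℂ) : ∃ b m, ψ δ0K = sgn b * δ m := by
  obtain ⟨m, h | h⟩ := emb_δ0K ψ
  · exact ⟨true, m, by simp [h]⟩
  · exact ⟨false, m, by simp [h]⟩

/-- (Ported verbatim from the HodgeCMPerL package; no docstring in the source.) -/
lemma conjugate_apply_δ0K (ψ : K →+* ℂ) {b : Bool} {m : Fin 3} (h : ψ δ0K = sgn b * δ m) :
    conjugate ψ δ0K = sgn (!b) * δ m := by
  rw [conjugate_coe_eq, h, map_mul, conj_δ, sgn_not]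
  cases b <;> simp

/-- The CM type with sign row `s` (relative to the frame): `{ψ | ψ(δ₀) = s_j δ_j for some j}`. -/
def typeOf (s : Fin 3 → Bool) : CMType K :=
  ⟨{ψ | ∃ j, ψ δ0K = sgn (s j) * δ j}, by
    intro ψ
    obtain ⟨b, m, hψ⟩ := emb_classify ψ
    have hc := conjugate_apply_δ0K ψ hψ
    simp only [Set.mem_setOf_eq, hψ, hc]
    constructor
    · rintro ⟨j, hj⟩ ⟨j', hj'⟩
      obtain ⟨h1, rfl⟩ := sgn_mul_δ_inj hj
      obtain ⟨h2, rfl⟩ := sgn_mul_δ_inj hj'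
      rw [← h1] at h2
      cases b <;> simp at h2
    · intro h
      refine ⟨m, ?_⟩
      by_contra hne
      apply h
      refine ⟨m, ?_⟩
      have : s m = !b := by
        cases b <;> cases hs : s m <;> simp_all
      rw [this]⟩

/-- PerL's four types. -/
def Ψfr (i : Fin 4) : CMType K := typeOf (perlSign i)

/-- (Ported verbatim from the HodgeCMPerL package; no docstring in the source.) -/
lemma isPerLTypes : IsPerLTypes φfr Ψfr := by
  intro i j
  change (φfr j ∈ {ψ : K →+* ℂ | ∃ j', ψ δ0K = sgn (perlSign i j') * δ j'}) ↔ _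
  simp only [Set.mem_setOf_eq, φfr_δ0K]
  constructor
  · rintro ⟨j', hj'⟩
    obtain ⟨h1, rfl⟩ := sgn_mul_δ_inj (b := true) (by simpa using hj')
    exact h1.symm
  · intro h
    exact ⟨j, by rw [h]; simp⟩

end HodgeCM.SexticCM
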